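import Literature.Barriers.RiemannHypothesis.EpsteinZetaStarkSetup
import Literature.NumberTheory.LFunctions.ZetaOneLineBounds
import HarnessLib

/-!
# Stark's theorem on the zeros of Epstein zeta functions, III: the size of `f` on the contour and on the critical line

Sixth proof file next to `Literature/Barriers/RiemannHypothesis/EpsteinZetaRealZeros.lean`. With
`f(s) = k^sΛ(2s)` (`Literature.Barriers.RiemannHypothesis.starkF`) and the rectangle
`R = [−1, 2] × [−T₀, T₀]` of Stark's Lemma 5, this file provides the quantitative comparisons behind
Rouché's theorem `|E_z| < |2f(s) + 2f(1−s)|` on `∂R` and `|E_z| < 4|f|` on the critical line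
(`E_z` the Bessel part, `‖E_z‖ ≤ 48√k e^{−1.4πk}`, `Literature.Barriers.RiemannHypothesis.norm_epsteinBesselPart_le`):

* right edge `σ = 2`: `|f(1−s)| ≤ ¼|f(s)|`, `|2f(s)+2f(1−s)| ≥ |f(s)| ≥ k²e^{−π|t|/2}/250`;
* top edge `t = T₀`, `½ < σ ≤ 2` (`k ≥ 3`, `|t| ≥ 1`): `|f(1−s)| ≤ e^{−(σ−½) log k}|f(s)|` (the
  domination `Literature.Barriers.RiemannHypothesis.norm_starkF_one_sub_le` with `|s/(s−1)| ≤ e^{σ−½}`),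
  hence `|2f(s)+2f(1−s)| ≥ min((σ−½)log k, 1)|f(s)|`, and `|f(σ+iT)| ≥ c₀ (2T)^{−7}·(2/15)π^{−2}√k e^{−πT/2}`
  (`½ ≤ σ ≤ 2`, `|T| ≥ 2`) from `1/|ζ(1+it)| ≪ log⁷t` (`ZetaOneLineBounds.lean`) and
  `|Γ(σ+iT)| ≥ (2/15)e^{−π|T|/2}` (`GammaStirlingOrder.lean`);
* near the corner `½ + iT₀`: `|f| ≤ 1600 k (1+|t|)² e^{−π|t|/2}` on `⅛ ≤ σ ≤ ⅞`, `|t| ≥ 1`, and, by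
  Cauchy's estimate on a circle of radius `¼`, `|f'| ≤ 11000 k (2+T)² e^{−πT/2}` on `[⅜, ⅝] + iT`
  (`T ≥ 2`), so that by the mean value inequality
  `|(2f(s)+2f(1−s)) − (2f(½+iT₀)+2f(½−iT₀))| ≤ 4 · 11000 k(2+T₀)²e^{−πT₀/2} · |σ − ½|` for
  `|σ − ½| ≤ ⅛` (this replaces the fine analysis of Stark's Lemma 4 near the line);
* on the critical line near `t = 0`: `|f(½+it)| ≥ c₂ (2/15)π^{−1/2} √k e^{−πt/2}` for `0 < t ≤ 2`,
  `c₂ = inf_{0<u≤4} |ζ(1+iu)| > 0`.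

All constants are absolute; `K`-largeness conditions are left to the final assembly.

## References

* [Stark1967EpsteinZeros] §3, Lemmas 1, 4, 5; §4.
* [Titchmarsh1986] §3.6 ((3.6.5): `1/ζ(1+it) = O(log⁷ t)`).
-/

noncomputable section

open Complex Filter Topology Set Metric

open scoped UpperHalfPlane Real ComplexConjugate

namespace Literature.Barriers.RiemannHypothesis

open Literature.NumberTheory.Automorphic
open Literature.NumberTheory.LFunctions
open Literature.Analysis.SpecialFunctions

/-! ## Lower bounds for `ζ` on `1 ≤ Re w ≤ 4` -/

/-- **An absolute polynomial lower bound for `ζ` to the right of `σ = 1`**: there is `c₀ > 0` with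
`‖ζ(w)‖ ≥ c₀/|Im w|⁷` for `1 ≤ Re w ≤ 4`, `|Im w| ≥ 4` (Titchmarsh (3.6.5) `1/ζ(1+it) = O(log⁷t)`,
the tree's `Literature.NumberTheory.LFunctions.ZetaOneLine.norm_riemannZeta_ge_inv_log_pow_seven`, and
`|ζ| ≥ 0.34` for `σ ≥ 2`). [cite: Titchmarsh1986, §3.6 (3.6.5)] -/
theorem exists_norm_riemannZeta_ge_div_pow :
    ∃ c₀ : ℝ, 0 < c₀ ∧ c₀ ≤ 1 / 4 ∧ ∀ w : ℂ, 1 ≤ w.re → w.re ≤ 4 → 4 ≤ |w.im| →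
      c₀ / |w.im| ^ 7 ≤ ‖riemannZeta w‖ := by
  set K : ℝ := 1134 * 16 * 336 ^ 4 with hK
  have hK0 : 0 < K := by rw [hK]; norm_num
  refine ⟨168 / K, by positivity, ?_, ?_⟩
  · rw [hK]; norm_num
  intro w h1 h4 ht
  have ht1 : 1 ≤ |w.im| := by linarith
  have hlog1 : 1 < Real.log |w.im| := by
    have := Real.log_le_log (by norm_num) ht
    have h4' : (1 : ℝ) < Real.log 4 := by
      have := Real.log_two_gt_d9
      rw [show (4 : ℝ) = 2 ^ 2 by norm_num, Real.log_pow]; push_cast; linarith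
    linarith
  have hlog0 : 0 < Real.log |w.im| := by linarith
  have hlt : Real.log |w.im| ≤ |w.im| := (Real.log_le_sub_one_of_pos (by linarith)).trans (by linarith)
  have hden : 168 / K / |w.im| ^ 7 ≤ 168 / (K * Real.log |w.im| ^ 7) := by
    rw [div_div, div_le_div_iff_of_pos_left (by norm_num) (by positivity) (by positivity)]
    have : Real.log |w.im| ^ 7 ≤ |w.im| ^ 7 := by gcongr
    nlinarith
  refine hden.trans ?_
  rcases le_or_gt w.re 2 with h2 | h2
  · have hσ : 1 - 1 / (2 * K * Real.log |w.im| ^ 9) ≤ w.re := by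
      have : 0 < 1 / (2 * K * Real.log |w.im| ^ 9) := by positivity
      linarith
    have h := ZetaOneLine.norm_riemannZeta_ge_inv_log_pow_seven (s := w) ht (by rw [← hK]; exact hσ) h2
    rwa [← hK] at h
  · have h := norm_riemannZeta_sub_one_le_of_two_le_re (s := w) h2.le
    have hp : (2 : ℝ) ^ (2 - w.re) ≤ 1 := Real.rpow_le_one_of_one_le_of_nonpos (by norm_num) (by linarith)
    have hc' : π ^ 2 / 6 - 1 ≤ 0.66 := by nlinarith [Real.pi_lt_d2, Real.pi_gt_three]
    have hc0 : 0 ≤ π ^ 2 / 6 - 1 := by nlinarith [Real.pi_gt_three]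
    have h' : ‖riemannZeta w - 1‖ ≤ 0.66 := h.trans (by nlinarith)
    have hge : 0.34 ≤ ‖riemannZeta w‖ := by
      have := norm_sub_norm_le 1 (riemannZeta w)
      rw [norm_one, norm_sub_rev] at this
      linarith
    refine le_trans ?_ hge
    rw [div_le_iff₀ (by positivity)]
    have : (1 : ℝ) ≤ Real.log |w.im| ^ 7 := one_le_pow₀ hlog1.le
    rw [hK]; nlinarith

/-- **An absolute lower bound for `ζ(1 + iu)`, `0 < u ≤ 4`** (pole at `u = 0`, continuity and
non-vanishing on the compact part). [folklore] -/
theorem exists_norm_riemannZeta_one_add_ge :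
    ∃ c₂ : ℝ, 0 < c₂ ∧ ∀ u : ℝ, 0 < u → u ≤ 4 → c₂ ≤ ‖riemannZeta (1 + u * I)‖ := by
  -- near the pole: `ζ₁(w) = (w−1)ζ(w)` is continuous with `ζ₁(1) = 1`
  have hc : ContinuousAt riemannZeta₁ 1 := differentiable_riemannZeta₁.continuous.continuousAt
  rw [Metric.continuousAt_iff] at hc
  obtain ⟨η, hη0, hη⟩ := hc (1 / 2) (by norm_num)
  set η' := min η 1 with hη'
  have hη'0 : 0 < η' := lt_min hη0 one_pos
  -- on `[η'/2, 4]`: a positive minimum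
  set g : ℝ → ℝ := fun u ↦ ‖riemannZeta (1 + u * I)‖ with hg
  have hgc : ContinuousOn g (Icc (η' / 2) 4) := by
    intro u hu
    have hu0 : 0 < u := by linarith [hu.1]
    have hw1 : (1 : ℂ) + u * I ≠ 1 := fun h ↦ hu0.ne' (by simpa using congrArg Complex.im h)
    exact ((differentiableAt_riemannZeta hw1).continuousAt.comp (f := fun u : ℝ ↦ (1 : ℂ) + u * I)
      (by fun_prop)).norm.continuousWithinAt
  obtain ⟨u₀, hu₀, hmin⟩ := isCompact_Icc.exists_isMinOn (nonempty_Icc.2 (by linarith [min_le_right η 1]))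
    hgc
  have hg0 : 0 < g u₀ := by
    have hu00 : 0 < u₀ := by linarith [hu₀.1]
    exact norm_pos_iff.2 (riemannZeta_ne_zero_of_one_le_re (by simp))
  refine ⟨min (1 / 2) (g u₀), lt_min (by norm_num) hg0, fun u hu0 hu4 ↦ ?_⟩
  rcases le_or_gt (η' / 2) u with h | h
  · exact (min_le_right _ _).trans (hmin ⟨h, hu4⟩)
  · -- `0 < u < η'/2 ≤ η/2`: `‖ζ₁(1+iu) − 1‖ < 1/2`, so `‖ζ(1+iu)‖ = ‖ζ₁‖/u ≥ (1/2)/u ≥ 1/2 · 2/η' ≥ 1/2`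
    have hu1 : (1 : ℂ) + u * I ≠ 1 := fun h' ↦ hu0.ne' (by simpa using congrArg Complex.im h')
    have hdist : dist ((1 : ℂ) + u * I) 1 < η := by
      rw [dist_eq_norm]; simp [abs_of_pos hu0]
      linarith [min_le_left η 1]
    have h1 := hη hdist
    rw [riemannZeta₁_one, dist_eq_norm] at h1
    have hζ₁ : riemannZeta₁ (1 + u * I) = (u * I) * riemannZeta (1 + u * I) := by
      rw [Literature.NumberTheory.LFunctions.riemannZeta₁_eq_mul hu1]; ring
    have hn : 1 / 2 ≤ ‖riemannZeta₁ (1 + u * I)‖ := by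
      have := norm_sub_norm_le 1 (riemannZeta₁ (1 + u * I))
      rw [norm_one, norm_sub_rev] at this
      linarith
    rw [hζ₁, norm_mul, norm_mul, Complex.norm_I, mul_one, Complex.norm_real, Real.norm_of_nonneg hu0.le] at hn
    refine (min_le_left _ _).trans ?_
    have hu1' : u ≤ 1 := by linarith [min_le_right η 1]
    have : u * ‖riemannZeta (1 + u * I)‖ ≤ 1 * ‖riemannZeta (1 + u * I)‖ :=
      mul_le_mul_of_nonneg_right hu1' (norm_nonneg _)
    linarith

/-! ## The right edge `σ = 2` -/

/-- On `σ = 2` and `k ≥ 2`: `|f(1−s)| ≤ ¼|f(s)|` (`k^{−3}·|s/(s−1)| ≤ 2k^{−3} ≤ ¼`).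
[cite: Stark1967EpsteinZeros, §3 Lemma 1 (20)] -/
theorem norm_starkF_one_sub_le_quarter (z : ℍ) (hk : 2 ≤ z.im) (t : ℝ) :
    ‖starkF z (1 - (2 + t * I))‖ ≤ 1 / 4 * ‖starkF z (2 + t * I)‖ := by
  have hy := z.im_pos
  set s : ℂ := 2 + t * I with hs
  have hsre : s.re = 2 := by simp [hs]
  have h := norm_starkF_one_sub_le z (s := s) (by rw [hsre]; norm_num) (by rw [hsre]; norm_num)
    (by intro h; have := congrArg Complex.re h; norm_num [hs] at this)
  rw [hsre] at h
  refine h.trans (mul_le_mul_of_nonneg_right ?_ (norm_nonneg _))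
  -- `k^{-3} · (‖s‖/‖s−1‖) ≤ (1/8)·2`
  have hratio : ‖s‖ / ‖s - 1‖ ≤ 2 := by
    have h1 : 0 < ‖s - 1‖ := norm_pos_iff.2 (by intro h; have := congrArg Complex.re h; norm_num [hs] at this)
    rw [div_le_iff₀ h1]
    have e1 : ‖s‖ ^ 2 = 4 + t ^ 2 := by rw [Complex.sq_norm, Complex.normSq_apply]; simp [hs]; ring
    have e2 : ‖s - 1‖ ^ 2 = 1 + t ^ 2 := by rw [Complex.sq_norm, Complex.normSq_apply]; simp [hs]; ring
    nlinarith [norm_nonneg s, norm_nonneg (s - 1)]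
  have hpow : z.im ^ (1 - 2 * (2 : ℝ)) ≤ 1 / 8 := by
    rw [show (1 - 2 * (2 : ℝ)) = -3 by norm_num, Real.rpow_neg hy.le, show (3 : ℝ) = (3 : ℕ) by norm_num,
      Real.rpow_natCast]
    rw [inv_le_comm₀ (by positivity) (by norm_num)]
    have h2 : (2 : ℝ) ^ 3 ≤ z.im ^ 3 := pow_le_pow_left₀ (by norm_num) hk 3
    norm_num at h2 ⊢
    linarith
  calc z.im ^ (1 - 2 * (2 : ℝ)) * (‖s‖ / ‖s - 1‖) ≤ 1 / 8 * 2 :=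
        mul_le_mul hpow hratio (by positivity) (by norm_num)
    _ = 1 / 4 := by norm_num

/-- On `σ = 2`, `k ≥ 2`: `|2f(s) + 2f(1−s)| ≥ |f(s)|`. [cite: Stark1967EpsteinZeros, §3 Lemma 1] -/
theorem norm_starkF_le_norm_two_mul_add_right (z : ℍ) (hk : 2 ≤ z.im) (t : ℝ) :
    ‖starkF z (2 + t * I)‖ ≤ ‖2 * starkF z (2 + t * I) + 2 * starkF z (1 - (2 + t * I))‖ := by
  have h := norm_starkF_one_sub_le_quarter z hk t
  have h1 : ‖2 * starkF z (2 + t * I)‖ - ‖2 * starkF z (1 - (2 + t * I))‖ ≤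
      ‖2 * starkF z (2 + t * I) + 2 * starkF z (1 - (2 + t * I))‖ := by
    have := norm_sub_norm_le (2 * starkF z (2 + t * I)) (-(2 * starkF z (1 - (2 + t * I))))
    rw [norm_neg, sub_neg_eq_add] at this
    exact this
  rw [norm_mul, norm_mul, Complex.norm_two] at h1
  linarith [norm_nonneg (starkF z (2 + t * I))]

/-- **`|f(2 + it)| ≥ k² e^{−π|t|/2}/250`** (`|Γ(2+it)| ≥ (2/15)e^{−π|t|/2}`, `|ζ(4+2it)| ≥ 0.34`, `π² ≤ 10`).
[cite: Stark1967EpsteinZeros, §3 Lemma 1 (18)] -/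
theorem norm_starkF_two_add_ge (z : ℍ) (t : ℝ) :
    z.im ^ 2 * Real.exp (-(π * |t|) / 2) / 250 ≤ ‖starkF z (2 + t * I)‖ := by
  have hy := z.im_pos
  have hre : (0 : ℝ) < ((2 : ℂ) + t * I).re := by simp
  rw [norm_starkF_eq z hre]
  have hsre : ((2 : ℂ) + t * I).re = 2 := by simp
  rw [hsre, Real.rpow_two]
  have hΓ : 2 / 15 * Real.exp (-(π * |t|) / 2) ≤ ‖Complex.Gamma (2 + t * I)‖ := by
    have := norm_Gamma_ge_exp (x := 2) (by norm_num) (by norm_num) t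
    simpa using this
  have hζ : 0.34 ≤ ‖riemannZeta (2 * (2 + t * I))‖ := by
    have h := norm_riemannZeta_sub_one_le_of_two_le_re (s := 2 * (2 + t * I)) (by simp)
    have hp : (2 : ℝ) ^ (2 - (2 * (2 + (t : ℂ) * I)).re) ≤ 1 :=
      Real.rpow_le_one_of_one_le_of_nonpos (by norm_num) (by simp)
    have hc' : π ^ 2 / 6 - 1 ≤ 0.66 := by nlinarith [Real.pi_lt_d2, Real.pi_gt_three]
    have hc0 : 0 ≤ π ^ 2 / 6 - 1 := by nlinarith [Real.pi_gt_three]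
    have h' : ‖riemannZeta (2 * (2 + t * I)) - 1‖ ≤ 0.66 := h.trans (by nlinarith)
    have := norm_sub_norm_le 1 (riemannZeta (2 * (2 + t * I)))
    rw [norm_one, norm_sub_rev] at this
    linarith
  have hπ : 1 / 10 ≤ π ^ (-(2 : ℝ)) := by
    rw [Real.rpow_neg Real.pi_pos.le, Real.rpow_two, le_inv_comm₀ (by norm_num) (by positivity)]
    nlinarith [Real.pi_lt_d2, Real.pi_pos]
  have hE := Real.exp_pos (-(π * |t|) / 2)
  calc z.im ^ 2 * Real.exp (-(π * |t|) / 2) / 250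
      ≤ z.im ^ 2 * (1 / 10 * (2 / 15 * Real.exp (-(π * |t|) / 2)) * 0.34) := by nlinarith
    _ ≤ z.im ^ 2 * (π ^ (-(2 : ℝ)) * ‖Complex.Gamma (2 + t * I)‖ * ‖riemannZeta (2 * (2 + t * I))‖) := by
        gcongr

/-- The derivative of `f` commutes with conjugation. [folklore] -/
theorem deriv_starkF_conj (z : ℍ) (s : ℂ) :
    deriv (starkF z) (conj s) = conj (deriv (starkF z) s) := by
  have hfun : (conj ∘ starkF z ∘ conj : ℂ → ℂ) = starkF z := by
    funext w; simp [Function.comp_apply, starkF_conj]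
  have h : deriv (conj ∘ starkF z ∘ conj : ℂ → ℂ) = conj ∘ deriv (starkF z) ∘ conj :=
    deriv_conj_conj
  rw [hfun] at h
  have h' := congrFun h (conj s)
  simpa using h'

/-! ## The top edge `t = T₀ ≥ 1`, `½ < σ ≤ 2` -/

/-- **Domination on the top edge**: for `k ≥ 3`, `½ < σ ≤ 2`, `|t| ≥ 1`,
`|f(1−s)| ≤ e^{−(σ−½) log k}|f(s)|` (`k^{1−2σ}|s/(s−1)| ≤ k^{1−2σ}e^{σ−½} ≤ k^{−(σ−½)}` as `log k ≥ 1`).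
[cite: LagariasSuzuki2006, Theorem 2.1 and §3] -/
theorem norm_starkF_one_sub_le_exp (z : ℍ) (hk : 3 ≤ z.im) {s : ℂ} (hs : 1 / 2 < s.re)
    (hs2 : s.re ≤ 2) (hT : 1 ≤ |s.im|) :
    ‖starkF z (1 - s)‖ ≤ Real.exp (-((s.re - 1 / 2) * Real.log z.im)) * ‖starkF z s‖ := by
  have hy := z.im_pos
  have h1 : s ≠ 1 := fun h ↦ by rw [h] at hT; norm_num at hT
  have h := norm_starkF_one_sub_le z hs (by linarith) h1
  refine h.trans (mul_le_mul_of_nonneg_right ?_ (norm_nonneg _))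
  have hlog : 1 ≤ Real.log z.im := by
    rw [Real.le_log_iff_exp_le hy]
    have := Real.exp_one_lt_d9
    linarith
  have hT2 : 1 ≤ s.im ^ 2 := by rw [← sq_abs]; nlinarith
  have hns : ‖s‖ ^ 2 = s.re ^ 2 + s.im ^ 2 := by
    rw [Complex.sq_norm, Complex.normSq_apply]; ring
  have hns1 : ‖s - 1‖ ^ 2 = (s.re - 1) ^ 2 + s.im ^ 2 := by
    rw [Complex.sq_norm, Complex.normSq_apply]; simp; ring
  have hn1 : 0 < ‖s - 1‖ := norm_pos_iff.2 (sub_ne_zero.2 h1)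
  have hexp1 : 2 * s.re ≤ Real.exp (2 * s.re - 1) := by
    have := Real.add_one_le_exp (2 * s.re - 1); linarith
  have he2 : Real.exp (s.re - 1 / 2) ^ 2 = Real.exp (2 * s.re - 1) := by
    rw [← Real.exp_nat_mul]; congr 1; push_cast; ring
  have hratio : ‖s‖ / ‖s - 1‖ ≤ Real.exp (s.re - 1 / 2) := by
    rw [div_le_iff₀ hn1, ← pow_le_pow_iff_left₀ (norm_nonneg _) (by positivity) two_ne_zero,
      mul_pow, he2, hns, hns1]
    have ha : 0 ≤ 2 * s.re - 1 := by linarith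
    nlinarith [mul_nonneg ha (sq_nonneg (s.re - 1)), mul_nonneg ha (show 0 ≤ s.im ^ 2 - 1 by linarith),
      mul_le_mul_of_nonneg_right hexp1 (show 0 ≤ (s.re - 1) ^ 2 + s.im ^ 2 by positivity)]
  rw [Real.rpow_def_of_pos hy]
  calc Real.exp (Real.log z.im * (1 - 2 * s.re)) * (‖s‖ / ‖s - 1‖)
      ≤ Real.exp (Real.log z.im * (1 - 2 * s.re)) * Real.exp (s.re - 1 / 2) := by gcongr
    _ = Real.exp (Real.log z.im * (1 - 2 * s.re) + (s.re - 1 / 2)) := by rw [Real.exp_add]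
    _ ≤ Real.exp (-((s.re - 1 / 2) * Real.log z.im)) := by
        rw [Real.exp_le_exp]; nlinarith

/-- **Lower bound for `|2f(s) + 2f(1−s)|` on the top edge**: for `k ≥ 3`, `½ < σ ≤ 2`, `|t| ≥ 1`,
`|2f(s) + 2f(1−s)| ≥ min((σ−½) log k, 1)|f(s)|` (`1 − e^{−x} ≥ ½ min(x, 1)`).
[cite: Stark1967EpsteinZeros, §3 Lemma 4 (28), (34)] -/
theorem norm_two_mul_starkF_add_ge (z : ℍ) (hk : 3 ≤ z.im) {s : ℂ} (hs : 1 / 2 < s.re)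
    (hs2 : s.re ≤ 2) (hT : 1 ≤ |s.im|) :
    min ((s.re - 1 / 2) * Real.log z.im) 1 * ‖starkF z s‖ ≤
      ‖2 * starkF z s + 2 * starkF z (1 - s)‖ := by
  have h := norm_starkF_one_sub_le_exp z hk hs hs2 hT
  set x := (s.re - 1 / 2) * Real.log z.im with hx
  have hx0 : 0 ≤ x := mul_nonneg (by linarith) (Real.log_nonneg (by linarith))
  have hexp_le : Real.exp (-x) ≤ 1 / (1 + x) := by
    rw [Real.exp_neg, one_div]
    exact inv_anti₀ (by linarith) (by linarith [Real.add_one_le_exp x])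
  have hkey : min x 1 ≤ 2 * (1 - Real.exp (-x)) := by
    rcases le_or_gt x 1 with hx1 | hx1
    · have h2 : 1 / (1 + x) ≤ 1 - x / 2 := by
        rw [div_le_iff₀ (by linarith)]; nlinarith
      have := min_le_left x 1
      linarith
    · have h2 : 1 / (1 + x) ≤ 1 / 2 := one_div_le_one_div_of_le two_pos (by linarith)
      have := min_le_right x 1
      linarith
  have hrev : ‖2 * starkF z s‖ - ‖2 * starkF z (1 - s)‖ ≤ ‖2 * starkF z s + 2 * starkF z (1 - s)‖ := by
    have := norm_sub_norm_le (2 * starkF z s) (-(2 * starkF z (1 - s)))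
    rwa [norm_neg, sub_neg_eq_add] at this
  rw [norm_mul, norm_mul, Complex.norm_two] at hrev
  have hf0 := norm_nonneg (starkF z s)
  calc min x 1 * ‖starkF z s‖ ≤ 2 * (1 - Real.exp (-x)) * ‖starkF z s‖ :=
        mul_le_mul_of_nonneg_right hkey hf0
    _ = 2 * ‖starkF z s‖ - 2 * (Real.exp (-x) * ‖starkF z s‖) := by ring
    _ ≤ 2 * ‖starkF z s‖ - 2 * ‖starkF z (1 - s)‖ := by linarith [h]
    _ ≤ _ := hrev

/-- **Lower bound for `|f(σ + it)|`, `½ ≤ σ ≤ 2`, `|t| ≥ 2`, `k ≥ 1`**: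
`|f| ≥ c₀ (2|t|)^{−7} · (2/15)π^{−2} · √k · e^{−π|t|/2}` (`k^σ ≥ √k`, `π^{−σ} ≥ π^{−2}`,
`|Γ(σ+it)| ≥ (2/15)e^{−π|t|/2}`, `|ζ(2s)| ≥ c₀/|2t|⁷`). [cite: Stark1967EpsteinZeros, §3 Lemma 4 (27)] -/
theorem norm_starkF_ge_of_half_le {c₀ : ℝ} (hc0 : 0 < c₀)
    (hc₀ : ∀ w : ℂ, 1 ≤ w.re → w.re ≤ 4 → 4 ≤ |w.im| → c₀ / |w.im| ^ 7 ≤ ‖riemannZeta w‖)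
    (z : ℍ) (hk : 1 ≤ z.im) {s : ℂ} (hs : 1 / 2 ≤ s.re) (hs2 : s.re ≤ 2) (hT : 2 ≤ |s.im|) :
    c₀ / (2 * |s.im|) ^ 7 * (2 / 15 * π ^ (-(2 : ℝ))) * Real.sqrt z.im * Real.exp (-(π * |s.im|) / 2) ≤
      ‖starkF z s‖ := by
  have hy := z.im_pos
  have hre : 0 < s.re := by linarith
  rw [norm_starkF_eq z hre]
  have hk' : Real.sqrt z.im ≤ z.im ^ s.re := by
    rw [Real.sqrt_eq_rpow]
    exact Real.rpow_le_rpow_of_exponent_le hk hs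
  have hπ' : π ^ (-(2 : ℝ)) ≤ π ^ (-s.re) :=
    Real.rpow_le_rpow_of_exponent_le (by linarith [Real.pi_gt_three]) (by linarith)
  have hΓ : 2 / 15 * Real.exp (-(π * |s.im|) / 2) ≤ ‖Complex.Gamma s‖ := by
    have := norm_Gamma_ge_exp (x := s.re) hs (by linarith) s.im
    rwa [re_add_im] at this
  have hζ : c₀ / (2 * |s.im|) ^ 7 ≤ ‖riemannZeta (2 * s)‖ := by
    have h2im : |(2 * s).im| = 2 * |s.im| := by simp [abs_mul]
    have := hc₀ (2 * s) (by simp; linarith) (by simp; linarith) (by rw [h2im]; linarith)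
    rwa [h2im] at this
  have hpos : 0 ≤ c₀ / (2 * |s.im|) ^ 7 := by positivity
  calc c₀ / (2 * |s.im|) ^ 7 * (2 / 15 * π ^ (-(2 : ℝ))) * Real.sqrt z.im * Real.exp (-(π * |s.im|) / 2)
      = Real.sqrt z.im * (π ^ (-(2 : ℝ)) * (2 / 15 * Real.exp (-(π * |s.im|) / 2)) *
          (c₀ / (2 * |s.im|) ^ 7)) := by ring
    _ ≤ z.im ^ s.re * (π ^ (-s.re) * ‖Complex.Gamma s‖ * ‖riemannZeta (2 * s)‖) := by
        gcongr

/-! ## Near the corner `½ + iT₀`: upper bounds for `f` and `f'` -/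

/-- **`|f(w)| ≤ 1600 k (1 + |t|)² e^{−π|t|/2}` for `⅛ ≤ Re w ≤ ⅞`, `|t| ≥ 1`, `k ≥ 1`**
(`k^σ ≤ k`, `π^{−σ} ≤ 1`, `|Γ| ≤ 16π²(1+|t|)^{1/2}e^{−π|t|/2}`, `|ζ(2w)| ≤ |2w|/|2w−1| + |2w|/(2σ) ≤ 9(1+|t|)`).
[cite: Stark1967EpsteinZeros, §3 (18)] -/
theorem norm_starkF_le_near (z : ℍ) (hk : 1 ≤ z.im) {w : ℂ} (h1 : 1 / 8 ≤ w.re) (h2 : w.re ≤ 7 / 8)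
    (hT : 1 ≤ |w.im|) :
    ‖starkF z w‖ ≤ 1600 * z.im * (1 + |w.im|) ^ 2 * Real.exp (-(π * |w.im|) / 2) := by
  have hy := z.im_pos
  have hre : 0 < w.re := by linarith
  rw [norm_starkF_eq z hre]
  have hkw : z.im ^ w.re ≤ z.im := by
    conv_rhs => rw [← Real.rpow_one z.im]
    exact Real.rpow_le_rpow_of_exponent_le hk (by linarith)
  have hπw : π ^ (-w.re) ≤ 1 :=
    Real.rpow_le_one_of_one_le_of_nonpos (by linarith [Real.pi_gt_three]) (by linarith)
  have hΓ : ‖Complex.Gamma w‖ ≤ 16 * π ^ 2 * (1 + |w.im|) ^ (1 / 2 : ℝ) * Real.exp (-(π * |w.im|) / 2) := by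
    have := norm_Gamma_le_exp (x := w.re) hre (by linarith) hT
    rwa [re_add_im] at this
  have hζ : ‖riemannZeta (2 * w)‖ ≤ 9 * (1 + |w.im|) := by
    have hu1 : 2 * w ≠ 1 := by
      intro h
      have := congrArg Complex.im h
      simp at this
      rw [this] at hT; norm_num at hT
    have h := norm_riemannZeta_le_of_re_pos (s := 2 * w) (by simp; linarith) hu1
    have hnw : ‖2 * w‖ ≤ 2 * (1 + |w.im|) := by
      rw [norm_mul, Complex.norm_two]
      have := Complex.norm_le_abs_re_add_abs_im w
      rw [abs_of_pos hre] at this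
      nlinarith
    have hn1 : 2 * |w.im| ≤ ‖2 * w - 1‖ := by
      have := Complex.abs_im_le_norm (2 * w - 1)
      have e : (2 * w - 1).im = 2 * w.im := by simp
      rw [e, abs_mul, abs_two] at this
      exact this
    have hre2 : (2 * w).re = 2 * w.re := by simp
    rw [hre2] at h
    have hA : ‖2 * w‖ / ‖2 * w - 1‖ ≤ 1 + |w.im| := by
      rw [div_le_iff₀ (by linarith)]
      nlinarith [abs_nonneg w.im]
    have hB : ‖2 * w‖ / (2 * w.re) ≤ 8 * (1 + |w.im|) := by
      rw [div_le_iff₀ (by linarith)]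
      nlinarith [abs_nonneg w.im]
    linarith
  have hsq : (1 + |w.im|) ^ (1 / 2 : ℝ) ≤ 1 + |w.im| := by
    conv_rhs => rw [← Real.rpow_one (1 + |w.im|)]
    exact Real.rpow_le_rpow_of_exponent_le (by linarith [abs_nonneg w.im]) (by norm_num)
  have hπ2 : π ^ 2 ≤ 10 := by nlinarith [Real.pi_lt_d2, Real.pi_pos]
  set E := Real.exp (-(π * |w.im|) / 2) with hE
  have hE0 : 0 < E := Real.exp_pos _
  set u := 1 + |w.im| with hu
  have hu1 : 1 ≤ u := by rw [hu]; linarith [abs_nonneg w.im]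
  calc z.im ^ w.re * (π ^ (-w.re) * ‖Complex.Gamma w‖ * ‖riemannZeta (2 * w)‖)
      ≤ z.im * (1 * (16 * π ^ 2 * u ^ (1 / 2 : ℝ) * E) * (9 * u)) := by gcongr
    _ ≤ z.im * (1 * (16 * 10 * u * E) * (9 * u)) := by gcongr
    _ = 1440 * z.im * u ^ 2 * E := by ring
    _ ≤ 1600 * z.im * u ^ 2 * E := by gcongr; norm_num

/-- `e^{2/5} ≤ 5/3`. [folklore] -/
theorem exp_two_fifths_le : Real.exp (2 / 5) ≤ 5 / 3 := by
  have h3 := Real.add_one_le_exp (-(2 / 5 : ℝ))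
  have h4 : Real.exp (2 / 5) * Real.exp (-(2 / 5)) = 1 := by rw [← Real.exp_add]; norm_num
  nlinarith [Real.exp_pos (2 / 5)]

/-- **Cauchy's estimate near the corner**: for `⅜ ≤ Re w ≤ ⅝`, `Im w = T ≥ 2`, `k ≥ 1`,
`|f'(w)| ≤ 11000 k (2 + T)² e^{−πT/2}` (Cauchy's inequality on the circle of radius `¼`, where
`|f| ≤ 1600k(1+T+¼)²e^{π/8}e^{−πT/2}`). [folklore] -/
theorem norm_deriv_starkF_le_near (z : ℍ) (hk : 1 ≤ z.im) {w : ℂ} (h1 : 3 / 8 ≤ w.re)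
    (h2 : w.re ≤ 5 / 8) (hT : 2 ≤ w.im) :
    ‖deriv (starkF z) w‖ ≤ 11000 * z.im * (2 + w.im) ^ 2 * Real.exp (-(π * w.im) / 2) := by
  have hy := z.im_pos
  set M := 1600 * z.im * (2 + w.im) ^ 2 * (Real.exp (π / 8) * Real.exp (-(π * w.im) / 2)) with hM
  have hR : (0 : ℝ) < 1 / 4 := by norm_num
  have him_of : ∀ u : ℂ, ‖u - w‖ ≤ 1 / 4 → |u.re - w.re| ≤ 1 / 4 ∧ |u.im - w.im| ≤ 1 / 4 := by
    intro u hu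
    refine ⟨?_, ?_⟩
    · have := Complex.abs_re_le_norm (u - w)
      rw [sub_re] at this
      exact this.trans hu
    · have := Complex.abs_im_le_norm (u - w)
      rw [sub_im] at this
      exact this.trans hu
  have hd : DiffContOnCl ℂ (starkF z) (ball w (1 / 4)) := by
    refine DifferentiableOn.diffContOnCl fun u hu ↦ ?_
    rw [closure_ball w hR.ne', mem_closedBall, dist_eq_norm] at hu
    obtain ⟨-, hi⟩ := him_of u hu
    obtain ⟨hi1, -⟩ := abs_le.1 hi
    have hu0 : u ≠ 0 := fun h ↦ by rw [h] at hi1; simp at hi1; linarith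
    have huh : u ≠ 1 / 2 := fun h ↦ by rw [h] at hi1; simp at hi1; linarith
    exact (differentiableAt_starkF z hu0 huh).differentiableWithinAt
  have hC : ∀ u ∈ sphere w (1 / 4), ‖starkF z u‖ ≤ M := by
    intro u hu
    rw [mem_sphere, dist_eq_norm] at hu
    obtain ⟨hr, hi⟩ := him_of u hu.le
    obtain ⟨hr1, hr2⟩ := abs_le.1 hr
    obtain ⟨hi1, hi2⟩ := abs_le.1 hi
    have huim0 : 0 < u.im := by linarith
    have huim : 1 ≤ |u.im| := by rw [abs_of_pos huim0]; linarith
    have h := norm_starkF_le_near z hk (w := u) (by linarith) (by linarith) huim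
    refine h.trans ?_
    rw [abs_of_pos huim0]
    have he : Real.exp (-(π * u.im) / 2) ≤ Real.exp (π / 8) * Real.exp (-(π * w.im) / 2) := by
      rw [← Real.exp_add, Real.exp_le_exp]; nlinarith [Real.pi_pos]
    have hb : (1 + u.im) ^ 2 ≤ (2 + w.im) ^ 2 := pow_le_pow_left₀ (by linarith) (by linarith) 2
    rw [hM]
    gcongr
  have hcauchy := Complex.norm_deriv_le_of_forall_mem_sphere_norm_le hR hd hC
  refine hcauchy.trans ?_
  have hexp : Real.exp (π / 8) ≤ 5 / 3 := by
    have hπ8 : π / 8 ≤ 2 / 5 := by linarith [Real.pi_lt_d2]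
    exact (Real.exp_le_exp.2 hπ8).trans exp_two_fifths_le
  have hpos : 0 ≤ z.im * (2 + w.im) ^ 2 * Real.exp (-(π * w.im) / 2) := by positivity
  rw [hM, div_eq_mul_inv, show ((1 : ℝ) / 4)⁻¹ = 4 by norm_num]
  nlinarith [mul_le_mul_of_nonneg_left hexp hpos]

/-- **The mean-value estimate near the corner** (replacing Stark's Lemma 4 near the line): for
`k ≥ 1`, `T₀ ≥ 2`, `|σ − ½| ≤ δ ≤ ⅛`, with `A(w) = 2f(w) + 2f(1−w)`,
`|A(σ + iT₀) − A(½ + iT₀)| ≤ 4 · 11000 k(2+T₀)²e^{−πT₀/2} · |σ − ½|` (`|A'| ≤ 4 sup|f'|` on the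
segment, `f'(1−w) = conj f'(1−w̄)`). [folklore] -/
theorem norm_starkA_sub_le (z : ℍ) (hk : 1 ≤ z.im) {T₀ δ : ℝ} (hT : 2 ≤ T₀) (hδ : δ ≤ 1 / 8) {σ : ℝ}
    (hσ : |σ - 1 / 2| ≤ δ) :
    ‖(2 * starkF z (σ + T₀ * I) + 2 * starkF z (1 - (σ + T₀ * I))) -
        (2 * starkF z (1 / 2 + T₀ * I) + 2 * starkF z (1 - (1 / 2 + T₀ * I)))‖ ≤
      4 * (11000 * z.im * (2 + T₀) ^ 2 * Real.exp (-(π * T₀) / 2)) * |σ - 1 / 2| := by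
  set D := 11000 * z.im * (2 + T₀) ^ 2 * Real.exp (-(π * T₀) / 2) with hD
  set A : ℂ → ℂ := fun w ↦ 2 * starkF z w + 2 * starkF z (1 - w) with hA
  set S : Set ℂ := Icc (3 / 8 : ℝ) (5 / 8) ×ℂ {T₀} with hS
  have hSconv : Convex ℝ S := by
    have e : convexHull ℝ S = S := by
      rw [hS, Complex.convexHull_reProdIm, (convex_Icc _ _).convexHull_eq,
        (convex_singleton _).convexHull_eq]
    rw [← e]
    exact convex_convexHull ℝ _
  have hmem : ∀ x : ℝ, x ∈ Icc (3 / 8 : ℝ) (5 / 8) → (x : ℂ) + T₀ * I ∈ S := fun x hx ↦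
    ⟨by simpa using hx, by simp⟩
  have hS_re : ∀ w ∈ S, 3 / 8 ≤ w.re ∧ w.re ≤ 5 / 8 := fun w hw ↦ ⟨hw.1.1, hw.1.2⟩
  have hS_im : ∀ w ∈ S, w.im = T₀ := fun w hw ↦ by simpa using hw.2
  have hderiv_f : ∀ w ∈ S, ‖deriv (starkF z) w‖ ≤ D := by
    intro w hw
    obtain ⟨hw1, hw2⟩ := hS_re w hw
    have hw3 := hS_im w hw
    have := norm_deriv_starkF_le_near z hk hw1 hw2 (by rw [hw3]; exact hT)
    rwa [hw3] at this
  have hne : ∀ w ∈ S, w ≠ 0 ∧ w ≠ 1 / 2 ∧ 1 - w ≠ 0 ∧ 1 - w ≠ 1 / 2 := by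
    intro w hw
    have hw3 := hS_im w hw
    refine ⟨fun h ↦ ?_, fun h ↦ ?_, fun h ↦ ?_, fun h ↦ ?_⟩
    · rw [h] at hw3; simp at hw3; linarith
    · rw [h] at hw3; simp at hw3; linarith
    · have := congrArg Complex.im h; simp at this; linarith
    · have := congrArg Complex.im h; simp at this; linarith
  have hderivA : ∀ w ∈ S, HasDerivAt A (2 * deriv (starkF z) w - 2 * deriv (starkF z) (1 - w)) w := by
    intro w hw
    obtain ⟨hw0, hwh, h1w0, h1wh⟩ := hne w hw
    have hf1 := (differentiableAt_starkF z hw0 hwh).hasDerivAt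
    have hf2 : HasDerivAt (fun w ↦ starkF z (1 - w)) (deriv (starkF z) (1 - w) * (-1)) w :=
      (differentiableAt_starkF z h1w0 h1wh).hasDerivAt.comp w ((hasDerivAt_id' w).const_sub 1)
    have := (hf1.const_mul 2).add (hf2.const_mul 2)
    have e : 2 * deriv (starkF z) w + 2 * (deriv (starkF z) (1 - w) * -1) =
        2 * deriv (starkF z) w - 2 * deriv (starkF z) (1 - w) := by ring
    rw [e] at this
    exact this
  have hdiff : ∀ w ∈ S, DifferentiableAt ℂ A w := fun w hw ↦ (hderivA w hw).differentiableAt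
  have hbound : ∀ w ∈ S, ‖deriv A w‖ ≤ 4 * D := by
    intro w hw
    rw [(hderivA w hw).deriv]
    have hn1 := hderiv_f w hw
    have hn2 : ‖deriv (starkF z) (1 - w)‖ ≤ D := by
      have e : 1 - w = conj (1 - conj w) := by simp
      rw [e, deriv_starkF_conj, Complex.norm_conj]
      apply hderiv_f
      obtain ⟨hw1, hw2⟩ := hS_re w hw
      have hw3 := hS_im w hw
      refine ⟨⟨?_, ?_⟩, ?_⟩
      · simp only [sub_re, one_re, Complex.conj_re]; linarith
      · simp only [sub_re, one_re, Complex.conj_re]; linarith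
      · simp [hw3]
    calc ‖2 * deriv (starkF z) w - 2 * deriv (starkF z) (1 - w)‖
        ≤ ‖2 * deriv (starkF z) w‖ + ‖2 * deriv (starkF z) (1 - w)‖ := norm_sub_le _ _
      _ ≤ 2 * D + 2 * D := by rw [norm_mul, norm_mul, Complex.norm_two]; linarith
      _ = 4 * D := by ring
  obtain ⟨hσ1, hσ2⟩ := abs_le.1 hσ
  have hx : (σ : ℂ) + T₀ * I ∈ S := hmem σ ⟨by linarith, by linarith⟩
  have hc : ((1 / 2 : ℝ) : ℂ) + T₀ * I ∈ S := hmem (1 / 2) ⟨by norm_num, by norm_num⟩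
  have h := hSconv.norm_image_sub_le_of_norm_deriv_le hdiff hbound hc hx
  have hdist : ‖((σ : ℂ) + T₀ * I) - (((1 / 2 : ℝ) : ℂ) + T₀ * I)‖ = |σ - 1 / 2| := by
    rw [show ((σ : ℂ) + T₀ * I) - (((1 / 2 : ℝ) : ℂ) + T₀ * I) = ((σ - 1 / 2 : ℝ) : ℂ) by push_cast; ring,
      Complex.norm_real, Real.norm_eq_abs]
  have ehalf : (((1 / 2 : ℝ) : ℂ) + T₀ * I) = 1 / 2 + T₀ * I := by push_cast; ring
  rw [hdist, ehalf] at h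
  simpa only [hA] using h

/-! ## On the critical line near `t = 0` -/

/-- **`|f(½ + it)| ≥ c₂ (2/15) π^{−1/2} √k e^{−πt/2}` for `0 < t ≤ 2`**, where
`c₂ ≤ |ζ(1 + iu)|` on `0 < u ≤ 4`. [cite: Stark1967EpsteinZeros, §4] -/
theorem norm_starkF_half_ge_small {c₂ : ℝ} (hc2 : 0 < c₂)
    (hc₂ : ∀ u : ℝ, 0 < u → u ≤ 4 → c₂ ≤ ‖riemannZeta (1 + u * I)‖)
    (z : ℍ) {t : ℝ} (ht0 : 0 < t) (ht2 : t ≤ 2) :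
    c₂ * (2 / 15 * π ^ (-(1 / 2 : ℝ))) * Real.sqrt z.im * Real.exp (-(π * t) / 2) ≤
      ‖starkF z (1 / 2 + t * I)‖ := by
  have hy := z.im_pos
  have hre : ((1 / 2 : ℂ) + t * I).re = 1 / 2 := by simp
  rw [norm_starkF_eq z (by rw [hre]; norm_num), hre, ← Real.sqrt_eq_rpow]
  have hΓ : 2 / 15 * Real.exp (-(π * t) / 2) ≤ ‖Complex.Gamma (1 / 2 + t * I)‖ := by
    have := norm_Gamma_ge_exp (x := 1 / 2) (by norm_num) (by norm_num) t
    rw [abs_of_pos ht0] at this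
    convert this using 2
    push_cast; ring
  have hζ : c₂ ≤ ‖riemannZeta (2 * (1 / 2 + t * I))‖ := by
    have := hc₂ (2 * t) (by linarith) (by linarith)
    convert this using 2
    push_cast; ring
  calc c₂ * (2 / 15 * π ^ (-(1 / 2 : ℝ))) * Real.sqrt z.im * Real.exp (-(π * t) / 2)
      = Real.sqrt z.im * (π ^ (-(1 / 2 : ℝ)) * (2 / 15 * Real.exp (-(π * t) / 2)) * c₂) := by ring
    _ ≤ Real.sqrt z.im * (π ^ (-(1 / 2 : ℝ)) * ‖Complex.Gamma (1 / 2 + t * I)‖ *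
          ‖riemannZeta (2 * (1 / 2 + t * I))‖) := by gcongr

end Literature.Barriers.RiemannHypothesis
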